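import Summits.CriticalPhenomena.PercolationContinuityZ3.Theorems.SahiBoxTP2BooleanSpins

/-!
# Two-valued spins over a countable index set (sites or bonds of `ℤ^d`): FKG-lattice cylinder probabilities suffice

Support file of the Sahi cell (`prim-sahi`, typer seat, generation 12; `--supports stmt-CriticalPhenomena-4575`).
Companion of `SahiBoxTP2BooleanSpins.lean` for an arbitrary countably infinite index set `ι` (enumeration
`e : ι ≃ ℕ`, relabelling `SahiBoxTP2HilbertReindex.reindex`).

* `isBoxTP2_of_fkg_cylinders` — **a probability measure on `{0,1}^ι` whose cylinder probabilities
  `μ{u : u|_J = x}` over every finite `J ⊆ ι` satisfy the FKG lattice condition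
  `μ{u|_J = x} μ{u|_J = y} ≤ μ{u|_J = x ∧ y} μ{u|_J = x ∨ y}` is box-TP₂** (the initial-segment cylinders of the
  relabelled configuration are the cylinders over `firstIndices e d`, `reindex_symm_preimage_cylinder`).  This is the
  hypothesis one verifies for weak limits of finite-volume FKG lattice measures (the condition is closed and passes to
  marginals).
* `msahiE_nonneg_of_fkg_cylinders` (+ `_of_sahiConjecture`, `_antitone`; `msahiE_nonneg_of_isBoxTP2_spins_countable`):
  **given `C_n` (⟺ `∀ d, LiebSahiContinuum d n`), `E_n(f_0,…,f_{n−1}) ≥ 0` for all measurable nonnegative monotone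
  `f_i : {0,1}^ι → ℝ`**; UNCONDITIONALLY `integral_mul_integral_le_of_fkg_cylinders(')`: the FKG inequality.

HONEST FRAMING (cell rule): `SahiConjecture n` (`n ≥ 3`) is OPEN and enters only as a hypothesis.  No sorries, no new
axioms.
-/

noncomputable section

namespace Summit.CriticalPhenomena.PercolationContinuityZ3.Theorems.SahiBoxTP2

open MeasureTheory ProbabilityTheory Set Filter Topology Function Literature.Combinatorics.Sahi2008
open scoped ENNReal unitInterval

section Countable

variable {ι : Type*}

/-- The finite set of the first `d` indices in the enumeration `e : ι ≃ ℕ`. -/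
def firstIndices (e : ι ≃ ℕ) (d : ℕ) : Finset ι :=
  (Finset.univ : Finset (Fin d)).map
    ⟨fun k : Fin d => e.symm (k : ℕ), fun _ _ h => Fin.val_injective (e.symm.injective h)⟩

/-- Members of `firstIndices e d` have label `< d`. [folklore] -/
theorem lt_of_mem_firstIndices {e : ι ≃ ℕ} {d : ℕ} {j : ι} (hj : j ∈ firstIndices e d) : e j < d := by
  obtain ⟨k, _, rfl⟩ := Finset.mem_map.1 hj
  simp only [Embedding.coeFn_mk, Equiv.apply_symm_apply]
  exact k.2

/-- `e.symm k ∈ firstIndices e d` for `k < d`. [folklore] -/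
theorem symm_mem_firstIndices (e : ι ≃ ℕ) {d : ℕ} (k : Fin d) : e.symm k ∈ firstIndices e d :=
  Finset.mem_map.2 ⟨k, Finset.mem_univ k, rfl⟩

/-- Transfer of a pattern `x : Fin d → Bool` to the first `d` indices of `ι`. -/
def patternOn (e : ι ≃ ℕ) (d : ℕ) (x : Fin d → Bool) : ↥(firstIndices e d) → Bool :=
  fun j => x ⟨e j, lt_of_mem_firstIndices j.2⟩

/-- `patternOn` is a lattice map (pointwise). [folklore] -/
theorem patternOn_inf (e : ι ≃ ℕ) (d : ℕ) (x y : Fin d → Bool) :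
    patternOn e d (x ⊓ y) = patternOn e d x ⊓ patternOn e d y := rfl

/-- `patternOn` is a lattice map (pointwise). [folklore] -/
theorem patternOn_sup (e : ι ≃ ℕ) (d : ℕ) (x y : Fin d → Bool) :
    patternOn e d (x ⊔ y) = patternOn e d x ⊔ patternOn e d y := rfl

/-- **The initial-segment cylinders of the relabelled configuration are the cylinders over the first `d` indices.**
[folklore] -/
theorem reindex_symm_preimage_cylinder (e : ι ≃ ℕ) (d : ℕ) (x : Fin d → Bool) :
    (reindex (X := Bool) e).symm ⁻¹' {v | finRestrict d v = x} =
      {u | (firstIndices e d).restrict u = patternOn e d x} := by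
  ext u
  simp only [mem_preimage, mem_setOf_eq]
  constructor
  · intro h
    funext j
    obtain ⟨k, _, hk⟩ := Finset.mem_map.1 j.2
    simp only [Embedding.coeFn_mk] at hk
    have hkx : finRestrict d ((reindex (X := Bool) e).symm u) k = x k := by rw [h]
    simp only [finRestrict_apply, reindex_symm_apply] at hkx
    simp only [Finset.restrict_def, patternOn]
    have hej : (⟨e j, lt_of_mem_firstIndices j.2⟩ : Fin d) = k := by
      refine Fin.ext ?_
      change e (j : ι) = (k : ℕ)
      rw [← hk, Equiv.apply_symm_apply]
    rw [hej, ← hkx, hk]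
  · intro h
    funext k
    have hj := congr_fun h ⟨e.symm k, symm_mem_firstIndices e k⟩
    simp only [Finset.restrict_def, patternOn] at hj
    simp only [finRestrict_apply, reindex_symm_apply, hj]
    congr 1
    exact Fin.ext (by simp)

/-- The initial-segment cylinders are measurable. [folklore] -/
theorem measurableSet_cylinder_finRestrict (d : ℕ) (x : Fin d → Bool) :
    MeasurableSet {v : ℕ → Bool | finRestrict d v = x} :=
  (measurableSet_singleton x).preimage (measurable_finRestrict d)

/-- **A probability measure on `{0,1}^ι` (`ι` countable) whose cylinder probabilities over finite index sets satisfy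
the FKG lattice condition is box-TP₂** — e.g. any weak limit of finite-volume FKG lattice measures on `ℤ^d`
(Ising `±`/free states, random-cluster limits), the condition being closed and hereditary to marginals. [this work] -/
theorem isBoxTP2_of_fkg_cylinders (e : ι ≃ ℕ) (μ : Measure (ι → Bool)) [IsFiniteMeasure μ]
    (hfkg : ∀ (J : Finset ι) (x y : ↥J → Bool),
      μ.real {u | J.restrict u = x} * μ.real {u | J.restrict u = y} ≤
        μ.real {u | J.restrict u = x ⊓ y} * μ.real {u | J.restrict u = x ⊔ y}) : IsBoxTP2 μ := by
  rw [← isBoxTP2_map_reindex_symm_iff e μ]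
  refine isBoxTP2_of_fkg_marginals _ fun d x y => ?_
  have hre : ∀ z : Fin d → Bool, (μ.map (reindex (X := Bool) e).symm).real {v | finRestrict d v = z} =
      μ.real {u | (firstIndices e d).restrict u = patternOn e d z} := fun z => by
    rw [measureReal_def, Measure.map_apply (measurableEmbedding_reindex_symm e).measurable
      (measurableSet_cylinder_finRestrict d z), reindex_symm_preimage_cylinder, ← measureReal_def]
  rw [hre, hre, hre, hre, patternOn_inf, patternOn_sup]
  exact hfkg _ _ _

/-- **Weak limits**: if the cylinder probabilities of `μ_k` converge to those of `μ` and every `μ_k` has FKG-lattice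
cylinder probabilities, so has `μ` (hence `μ` is box-TP₂) — e.g. infinite-volume limits of finite-volume FKG lattice
measures. [folklore] -/
theorem fkg_cylinders_of_tendsto {μs : ℕ → Measure (ι → Bool)} {μ : Measure (ι → Bool)}
    (hlim : ∀ (J : Finset ι) (x : ↥J → Bool),
      Tendsto (fun k => (μs k).real {u | J.restrict u = x}) atTop (𝓝 (μ.real {u | J.restrict u = x})))
    (hfkg : ∀ (k : ℕ) (J : Finset ι) (x y : ↥J → Bool),
      (μs k).real {u | J.restrict u = x} * (μs k).real {u | J.restrict u = y} ≤
        (μs k).real {u | J.restrict u = x ⊓ y} * (μs k).real {u | J.restrict u = x ⊔ y})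
    (J : Finset ι) (x y : ↥J → Bool) :
    μ.real {u | J.restrict u = x} * μ.real {u | J.restrict u = y} ≤
      μ.real {u | J.restrict u = x ⊓ y} * μ.real {u | J.restrict u = x ⊔ y} :=
  le_of_tendsto_of_tendsto' ((hlim J x).mul (hlim J y)) ((hlim J _).mul (hlim J _)) fun k => hfkg k J x y

variable {n : ℕ}

/-- **`(∀ d, LiebSahiContinuum d n)` ⟹ every box-TP₂ probability measure on `{0,1}^ι` (`ι ≃ ℕ`) is Sahi-positive of
order `n`.** [this work] -/
theorem msahiE_nonneg_of_isBoxTP2_spins_countable (e : ι ≃ ℕ) (hL : ∀ d, LiebSahiContinuum d n)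
    (μ : Measure (ι → Bool)) [IsProbabilityMeasure μ] (hμ : IsBoxTP2 μ) (f : Fin n → (ι → Bool) → ℝ)
    (hfm : ∀ i, Measurable (f i)) (hf0 : ∀ i u, 0 ≤ f i u) (hmono : ∀ i, Monotone (f i)) : 0 ≤ msahiE μ n f := by
  rw [← msahiE_comp_measurePreserving (measurePreserving_reindex e μ) (measurableEmbedding_reindex e) n f]
  exact msahiE_nonneg_of_isBoxTP2_spins hL _ ((isBoxTP2_map_reindex_symm_iff e μ).2 hμ) _
    (fun i => (hfm i).comp (measurableEmbedding_reindex e).measurable) (fun i u => hf0 i _)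
    fun i u v huv => hmono i ((reindex e).monotone huv)

/-- Decreasing families. [this work] -/
theorem msahiE_nonneg_of_isBoxTP2_spins_countable_antitone (e : ι ≃ ℕ) (hL : ∀ d, LiebSahiContinuum d n)
    (μ : Measure (ι → Bool)) [IsProbabilityMeasure μ] (hμ : IsBoxTP2 μ) (f : Fin n → (ι → Bool) → ℝ)
    (hfm : ∀ i, Measurable (f i)) (hf0 : ∀ i u, 0 ≤ f i u) (hanti : ∀ i, Antitone (f i)) : 0 ≤ msahiE μ n f := by
  rw [← msahiE_comp_measurePreserving (measurePreserving_reindex e μ) (measurableEmbedding_reindex e) n f]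
  exact msahiE_nonneg_of_isBoxTP2_spins_antitone hL _ ((isBoxTP2_map_reindex_symm_iff e μ).2 hμ) _
    (fun i => (hfm i).comp (measurableEmbedding_reindex e).measurable) (fun i u => hf0 i _)
    fun i u v huv => hanti i ((reindex e).monotone huv)

/-- **THEOREM (two-valued spins over a countable index set).** If `LiebSahiContinuum d n` holds for every `d`
(⟺ `SahiConjecture n`), then every probability measure on `{0,1}^ι`, `ι` countably infinite, whose cylinder
probabilities over finite index sets satisfy the FKG lattice condition has `E_n(f_0,…,f_{n−1}) ≥ 0` for ALL measurable
nonnegative monotone `f_i` — functions of the whole configuration (`1{0 ↔ ∞}`, …). [this work] -/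
theorem msahiE_nonneg_of_fkg_cylinders (e : ι ≃ ℕ) (hL : ∀ d, LiebSahiContinuum d n) (μ : Measure (ι → Bool))
    [IsProbabilityMeasure μ]
    (hfkg : ∀ (J : Finset ι) (x y : ↥J → Bool),
      μ.real {u | J.restrict u = x} * μ.real {u | J.restrict u = y} ≤
        μ.real {u | J.restrict u = x ⊓ y} * μ.real {u | J.restrict u = x ⊔ y})
    (f : Fin n → (ι → Bool) → ℝ) (hfm : ∀ i, Measurable (f i)) (hf0 : ∀ i u, 0 ≤ f i u)
    (hmono : ∀ i, Monotone (f i)) : 0 ≤ msahiE μ n f :=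
  msahiE_nonneg_of_isBoxTP2_spins_countable e hL μ (isBoxTP2_of_fkg_cylinders e μ hfkg) f hfm hf0 hmono

/-- From `C_n`. [this work; cite: Sahi2008, Conj. 5 (p. 212); LiebSahi2021, Conj. 1.1] -/
theorem msahiE_nonneg_of_fkg_cylinders_of_sahiConjecture (e : ι ≃ ℕ) (hC : SahiConjecture n)
    (μ : Measure (ι → Bool)) [IsProbabilityMeasure μ]
    (hfkg : ∀ (J : Finset ι) (x y : ↥J → Bool),
      μ.real {u | J.restrict u = x} * μ.real {u | J.restrict u = y} ≤
        μ.real {u | J.restrict u = x ⊓ y} * μ.real {u | J.restrict u = x ⊔ y})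
    (f : Fin n → (ι → Bool) → ℝ) (hfm : ∀ i, Measurable (f i)) (hf0 : ∀ i u, 0 ≤ f i u)
    (hmono : ∀ i, Monotone (f i)) : 0 ≤ msahiE μ n f :=
  msahiE_nonneg_of_fkg_cylinders e ((sahiConjecture_iff_forall_liebSahiContinuum n).1 hC) μ hfkg f hfm hf0 hmono

/-- Decreasing families, from the cylinder condition. [this work] -/
theorem msahiE_nonneg_of_fkg_cylinders_antitone (e : ι ≃ ℕ) (hL : ∀ d, LiebSahiContinuum d n)
    (μ : Measure (ι → Bool)) [IsProbabilityMeasure μ]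
    (hfkg : ∀ (J : Finset ι) (x y : ↥J → Bool),
      μ.real {u | J.restrict u = x} * μ.real {u | J.restrict u = y} ≤
        μ.real {u | J.restrict u = x ⊓ y} * μ.real {u | J.restrict u = x ⊔ y})
    (f : Fin n → (ι → Bool) → ℝ) (hfm : ∀ i, Measurable (f i)) (hf0 : ∀ i u, 0 ≤ f i u)
    (hanti : ∀ i, Antitone (f i)) : 0 ≤ msahiE μ n f :=
  msahiE_nonneg_of_isBoxTP2_spins_countable_antitone e hL μ (isBoxTP2_of_fkg_cylinders e μ hfkg) f hfm hf0 hanti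

/-- **Unconditionally: the FKG inequality in infinite volume over a countable index set.**  A probability measure on
`{0,1}^ι` with FKG-lattice cylinder probabilities is positively associated: `∫ f ∫ g ≤ ∫ f g` for all measurable
nonnegative monotone `f, g`. [this work] -/
theorem integral_mul_integral_le_of_fkg_cylinders (e : ι ≃ ℕ) (μ : Measure (ι → Bool)) [IsProbabilityMeasure μ]
    (hfkg : ∀ (J : Finset ι) (x y : ↥J → Bool),
      μ.real {u | J.restrict u = x} * μ.real {u | J.restrict u = y} ≤
        μ.real {u | J.restrict u = x ⊓ y} * μ.real {u | J.restrict u = x ⊔ y})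
    {f g : (ι → Bool) → ℝ} (hfm : Measurable f) (hgm : Measurable g) (hf0 : ∀ u, 0 ≤ f u) (hg0 : ∀ u, 0 ≤ g u)
    (hf : Monotone f) (hg : Monotone g) : (∫ u, f u ∂μ) * (∫ u, g u ∂μ) ≤ ∫ u, f u * g u ∂μ := by
  have h := msahiE_nonneg_of_fkg_cylinders e (fun d => liebSahiContinuum_of_order_le_two d le_rfl) μ hfkg ![f, g]
    (fun i => by fin_cases i <;> assumption) (fun i => by fin_cases i <;> assumption)
    (fun i => by fin_cases i <;> assumption)
  rw [msahiE_two] at h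
  linarith

/-- The same with `[Countable ι] [Infinite ι]`. [this work] -/
theorem integral_mul_integral_le_of_fkg_cylinders' [Countable ι] [Infinite ι] (μ : Measure (ι → Bool))
    [IsProbabilityMeasure μ]
    (hfkg : ∀ (J : Finset ι) (x y : ↥J → Bool),
      μ.real {u | J.restrict u = x} * μ.real {u | J.restrict u = y} ≤
        μ.real {u | J.restrict u = x ⊓ y} * μ.real {u | J.restrict u = x ⊔ y})
    {f g : (ι → Bool) → ℝ} (hfm : Measurable f) (hgm : Measurable g) (hf0 : ∀ u, 0 ≤ f u) (hg0 : ∀ u, 0 ≤ g u)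
    (hf : Monotone f) (hg : Monotone g) : (∫ u, f u ∂μ) * (∫ u, g u ∂μ) ≤ ∫ u, f u * g u ∂μ := by
  obtain ⟨D⟩ := nonempty_denumerable ι
  exact integral_mul_integral_le_of_fkg_cylinders (Denumerable.eqv ι) μ hfkg hfm hgm hf0 hg0 hf hg

end Countable

end Summit.CriticalPhenomena.PercolationContinuityZ3.Theorems.SahiBoxTP2
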